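import Summits.NavierStokesRegularity.NavierStokesRegularity.Theorems.FilamentSkeletonRssSkeletonJ1RLiaSelfSplit
import Summits.NavierStokesRegularity.NavierStokesRegularity.Theorems.FilamentSkeletonRssSkeletonEquilibriumRosenheadMoments
import Summits.NavierStokesRegularity.NavierStokesRegularity.Theorems.FilamentSkeletonRssSkeletonEquilibriumRosenheadMomentBounds

/-!
# Route `FilamentSkeletonRss` · crux `SkeletonJ1R` (stmt-NavierStokesRegularity-23610) · stub F2 `LiaDefectL` — SELF-STRAND BRICK (S2):
# kernel toolkit and the LOGARITHMIC-WINDOW majorant frame for the Biot–Savart self-induction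

Lead `ns-fsr-lead-23610` (g2), line `streamline_kantorovich_R` (skeleton of record v5).  Helper file `--supports stmt-NavierStokesRegularity-23610`;
route-independent (no `Theses` import).  Builds on brick S1 (`…SkeletonJ1RLiaSelfSplit`: the split `X′σ × (Xτ − Xσ) = X′τ × A − R₂`) and on
the landed Rosenhead-kernel moments (`SkeletonEquilibrium.Sketch.stub_rosenheadMoments` / `…MomentBounds`).

Kernel `K_e(r) = ((r² + e²)^{3/2})⁻¹` (the crux's regularised Biot–Savart kernel; `e² = exp(−(1+γ_E−log 2))` at unit cores), self-strand
integrand `F(σ) = K_e(‖X τ − X σ‖) • X′σ × (X τ − X σ)` of a unit-speed `C²` curve, frozen model on the window `|σ − τ| ≤ R`: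
`G(σ) = K_e(σ − τ)·((σ−τ)²/2) • X′τ × X″τ`, whose integral is the Rosenhead coefficient `Λ_e(R) = arsinh(R/e) − R/√(R²+e²)`
(`= log(2R/e) − 1 + O(e²/R²)`; with `R ≍ √Γ` this is the `½ log Γ` of `liaCoeff`).
* §1 kernel toolkit: `K_e(r) ≤ r⁻³`, `K_e ≤ e⁻³`, the MULTIPLICATIVE chord comparison `K_e(r) ≤ (1−η)⁻³ K_e(s)` for `(1−η)|s| ≤ r`
  (so `K_e(chord) − K_e(|s|) ≤ 16η·K_e(|s|)` for `η ≤ 1/2` — no mean-value theorem needed), and the translated window identity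
  `∫_{τ−R}^{τ+R} K_e(σ−τ)(σ−τ)²/2 dσ = Λ_e(R)`.
* §2 pointwise majorants: INNER (`|σ−τ| ≤ R`, segment curvature `κ`, `X″` `H`-Lipschitz about `τ`, chord `≥ (1−η)|σ−τ|`):
  `‖F σ − G σ‖ ≤ 8H + 8κ² + 16η‖X″τ‖·K_e(σ−τ)(σ−τ)²/2`; OUTER (chord `≥ c|σ−τ|`, `‖A‖ ≤ gA`, `‖R₂‖ ≤ gR`): `‖F σ‖ ≤ (gA + gR)/(c³|σ−τ|³)`.
* §3 the frame: if `‖F − 𝟙_{[τ−R, τ+R]} G‖ ≤ m` pointwise with `m` integrable then `F` is integrable and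
  `‖∫ F − Λ_e(R) • X′τ × X″τ‖ ≤ ∫ m` (`selfStrand_sub_lia_le_of_majorant`).  No new definitions: `F`, `G`, `Λ_e` are written out.
The envelope-specific integration of `m` for the LIA reference (curvature envelope linear in `|σ|`, compact support) is brick S3.
HONEST FRAMING: MODEL rung, ∃-side helper lemmas (kernel calculus) toward stub F2 of a HYPOTHETICAL filament-type blow-up skeleton; F2 and the
crux 23610 stay OPEN; nothing here bears on Navier–Stokes regularity, which is NOT proved. [folklore]
-/

-- `dupNamespace` off: the module name repeats `NavierStokesRegularity` by the tree's `Summits/<S>/<S>/Theorems` layout (same as every sibling file).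
set_option linter.dupNamespace false

noncomputable section

namespace Summit.NavierStokesRegularity.NavierStokesRegularity.Theorems.SkeletonJ1RLiaSelf

open MeasureTheory Set intervalIntegral Filter
open Literature.Analysis.FluidPDE
open Summit.NavierStokesRegularity.NavierStokesRegularity.Theorems.SkeletonEquilibrium.Sketch (stub_rosenheadMoments stub_rosenheadMomentBounds)
open scoped RealInnerProductSpace InnerProductSpace BigOperators Interval Topology

/-! ## §1 Kernel toolkit -/

/-- `b^{3/2} = b·√b` for `b > 0`. [folklore] -/
private theorem rpow_three_halves_eq {b : ℝ} (hb : 0 < b) : b ^ (3 / 2 : ℝ) = b * Real.sqrt b := by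
  rw [show (3 / 2 : ℝ) = 1 + 1 / 2 by norm_num, Real.rpow_add hb, Real.rpow_one, Real.sqrt_eq_rpow]

/-- The kernel is positive. [folklore] -/
theorem kernel_pos (e r : ℝ) (he : 0 < e) : 0 < ((r ^ 2 + e ^ 2) ^ (3 / 2 : ℝ))⁻¹ :=
  inv_pos.2 (Real.rpow_pos_of_pos (by positivity) _)

/-- `K_e(r) ≤ r⁻³` for `r > 0`. [folklore] -/
theorem kernel_le_inv_cube {r : ℝ} (hr : 0 < r) (e : ℝ) : ((r ^ 2 + e ^ 2) ^ (3 / 2 : ℝ))⁻¹ ≤ (r ^ 3)⁻¹ := by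
  have h1 : r ^ 3 = (r ^ 2) ^ (3 / 2 : ℝ) := by
    rw [rpow_three_halves_eq (by positivity : (0:ℝ) < r ^ 2), Real.sqrt_sq hr.le]; ring
  rw [h1]
  exact inv_anti₀ (Real.rpow_pos_of_pos (by positivity) _)
    (Real.rpow_le_rpow (by positivity) (by nlinarith [sq_nonneg e]) (by norm_num))

/-- `r³·K_e(r) ≤ 1` for `r ≥ 0` (the cubic moment is bounded; landed `stub_rosenheadMomentBounds` (1) with `|r| = r`). [folklore] -/
theorem cube_mul_kernel_le_one {r e : ℝ} (hr : 0 ≤ r) (he : 0 < e) : r ^ 3 * ((r ^ 2 + e ^ 2) ^ (3 / 2 : ℝ))⁻¹ ≤ 1 := by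
  have h := stub_rosenheadMomentBounds.1 e r he
  rwa [abs_of_nonneg hr] at h

/-- `K_e(r) ≤ e⁻³` (the regularised kernel is bounded). [folklore] -/
theorem kernel_le_core {e : ℝ} (he : 0 < e) (r : ℝ) : ((r ^ 2 + e ^ 2) ^ (3 / 2 : ℝ))⁻¹ ≤ (e ^ 3)⁻¹ := by
  have h1 : e ^ 3 = (e ^ 2) ^ (3 / 2 : ℝ) := by
    rw [rpow_three_halves_eq (by positivity : (0:ℝ) < e ^ 2), Real.sqrt_sq he.le]; ring
  rw [h1]
  exact inv_anti₀ (Real.rpow_pos_of_pos (by positivity) _)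
    (Real.rpow_le_rpow (by positivity) (by nlinarith [sq_nonneg r]) (by norm_num))

/-- **Multiplicative chord comparison.**  If `0 ≤ η < 1` and `(1 − η)|s| ≤ r` with `r ≥ 0` (a chord at least `(1−η)` times the arclength) then
`K_e(r) ≤ (1−η)⁻³ · K_e(s)` (so `r ≥ 0` automatically).  (Monotonicity of `t ↦ t^{3/2}` and `(1−η)²(s² + e²) ≤ r² + e²`; no mean-value theorem.) [folklore] -/
theorem kernel_chord_le {e η s r : ℝ} (he : 0 < e) (hη0 : 0 ≤ η) (hη1 : η < 1) (hcmp : (1 - η) * |s| ≤ r) :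
    ((r ^ 2 + e ^ 2) ^ (3 / 2 : ℝ))⁻¹ ≤ ((1 - η) ^ 3)⁻¹ * ((s ^ 2 + e ^ 2) ^ (3 / 2 : ℝ))⁻¹ := by
  have h1η : 0 < 1 - η := by linarith
  have hu : 0 < (1 - η) ^ 2 * (s ^ 2 + e ^ 2) := by positivity
  have huv : (1 - η) ^ 2 * (s ^ 2 + e ^ 2) ≤ r ^ 2 + e ^ 2 := by
    have h2 : ((1 - η) * |s|) ^ 2 ≤ r ^ 2 := pow_le_pow_left₀ (by positivity) hcmp 2
    rw [mul_pow, sq_abs] at h2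
    nlinarith [sq_nonneg e, mul_le_mul_of_nonneg_right (show (1 - η) ^ 2 ≤ 1 by nlinarith) (sq_nonneg e)]
  have hpow : ((1 - η) ^ 2) ^ (3 / 2 : ℝ) = (1 - η) ^ 3 := by
    rw [show ((1:ℝ) - η) ^ 2 = (1 - η) ^ ((2:ℕ):ℝ) from (Real.rpow_natCast _ 2).symm, ← Real.rpow_mul h1η.le,
      show ((2:ℕ):ℝ) * (3 / 2 : ℝ) = ((3:ℕ):ℝ) by norm_num, Real.rpow_natCast]
  have hmul : ((1 - η) ^ 2 * (s ^ 2 + e ^ 2)) ^ (3 / 2 : ℝ) = (1 - η) ^ 3 * (s ^ 2 + e ^ 2) ^ (3 / 2 : ℝ) := by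
    rw [Real.mul_rpow (by positivity) (by positivity), hpow]
  calc ((r ^ 2 + e ^ 2) ^ (3 / 2 : ℝ))⁻¹ ≤ (((1 - η) ^ 2 * (s ^ 2 + e ^ 2)) ^ (3 / 2 : ℝ))⁻¹ :=
        inv_anti₀ (Real.rpow_pos_of_pos hu _) (Real.rpow_le_rpow hu.le huv (by norm_num))
    _ = ((1 - η) ^ 3)⁻¹ * ((s ^ 2 + e ^ 2) ^ (3 / 2 : ℝ))⁻¹ := by rw [hmul, mul_inv]

/-- `(1−η)⁻³ − 1 ≤ 16η` for `0 ≤ η ≤ 1/2`. [folklore] -/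
theorem inv_cube_sub_one_le {η : ℝ} (hη0 : 0 ≤ η) (hη1 : η ≤ 1 / 2) : ((1 - η) ^ 3)⁻¹ - 1 ≤ 16 * η := by
  have h1η : 0 < 1 - η := by linarith
  have h3 : 0 < (1 - η) ^ 3 := pow_pos h1η 3
  rw [sub_le_iff_le_add, inv_le_iff_one_le_mul₀ h3]
  nlinarith [mul_nonneg hη0 (sub_nonneg.2 hη1), mul_nonneg (mul_nonneg hη0 hη0) (sub_nonneg.2 hη1),
    mul_nonneg (mul_nonneg hη0 hη0) hη0, mul_nonneg (mul_nonneg (mul_nonneg hη0 hη0) hη0) (sub_nonneg.2 hη1)]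

/-- `(1−η)⁻³ ≤ 8` for `η ≤ 1/2`. [folklore] -/
theorem inv_cube_le_eight {η : ℝ} (hη1 : η ≤ 1 / 2) : ((1 - η) ^ 3)⁻¹ ≤ 8 := by
  have h1η : (1:ℝ) / 2 ≤ 1 - η := by linarith
  have h3 : (1:ℝ) / 8 ≤ (1 - η) ^ 3 := by nlinarith [pow_le_pow_left₀ (by norm_num : (0:ℝ) ≤ 1 / 2) h1η 3]
  calc ((1 - η) ^ 3)⁻¹ ≤ ((1:ℝ) / 8)⁻¹ := inv_anti₀ (by norm_num) h3
    _ = 8 := by norm_num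

/-- **Kernel difference along a chord**: `K_e(r) − K_e(s) ≤ 16η·K_e(s)` when `(1−η)|s| ≤ r`, `0 ≤ η ≤ 1/2`. [folklore] -/
theorem kernel_chord_sub_le {e η s r : ℝ} (he : 0 < e) (hη0 : 0 ≤ η) (hη1 : η ≤ 1 / 2) (hcmp : (1 - η) * |s| ≤ r) :
    ((r ^ 2 + e ^ 2) ^ (3 / 2 : ℝ))⁻¹ - ((s ^ 2 + e ^ 2) ^ (3 / 2 : ℝ))⁻¹ ≤ 16 * η * ((s ^ 2 + e ^ 2) ^ (3 / 2 : ℝ))⁻¹ := by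
  have h := kernel_chord_le he hη0 (by linarith) hcmp
  have hK := (kernel_pos e s he).le
  have h16 := inv_cube_sub_one_le hη0 hη1
  nlinarith [mul_le_mul_of_nonneg_right h16 hK]

/-- **Translated window identity**: `∫_{τ−R}^{τ+R} K_e(σ−τ)·(σ−τ)²/2 dσ = Λ_e(R)` (`R ≥ 0`, `e > 0`; landed `stub_rosenheadMoments`). [folklore] -/
theorem integral_window_model {e : ℝ} (he : 0 < e) (τ : ℝ) {R : ℝ} (hR : 0 ≤ R) :
    ∫ σ in (τ - R)..(τ + R), (((σ - τ) ^ 2 + e ^ 2) ^ (3 / 2 : ℝ))⁻¹ * ((σ - τ) ^ 2 / 2) = (Real.arsinh (R / e) - R / Real.sqrt (R ^ 2 + e ^ 2)) := by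
  have h := intervalIntegral.integral_comp_sub_right (fun s : ℝ => ((s ^ 2 + e ^ 2) ^ (3 / 2 : ℝ))⁻¹ * (s ^ 2 / 2)) τ
    (a := τ - R) (b := τ + R)
  simp only [show τ - R - τ = -R by ring, add_sub_cancel_left] at h
  rw [h]
  have h2 := stub_rosenheadMoments.2.2 e R he hR
  have h3 : (fun s : ℝ => ((s ^ 2 + e ^ 2) ^ (3 / 2 : ℝ))⁻¹ * (s ^ 2 / 2)) =
      fun s : ℝ => (1 / 2 : ℝ) * (s ^ 2 * ((s ^ 2 + e ^ 2) ^ (3 / 2 : ℝ))⁻¹) := by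
    funext s; ring
  rw [h3, intervalIntegral.integral_const_mul, h2]
  ring

/-- **Asymptotics of the window coefficient** (landed `stub_rosenheadMomentBounds` (3)): `|Λ_e(R) − (log(2R/e) − 1)| ≤ e²/R²` for `0 < e ≤ R`.
[folklore] -/
theorem abs_liaWindowCoeff_sub_log_le {e R : ℝ} (he : 0 < e) (hR : e ≤ R) :
    |(Real.arsinh (R / e) - R / Real.sqrt (R ^ 2 + e ^ 2)) - (Real.log (2 * R / e) - 1)| ≤ e ^ 2 / R ^ 2 := by
  obtain ⟨h1, h2⟩ := stub_rosenheadMomentBounds.2.2 e R he hR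
  rw [abs_le]
  constructor <;> linarith

/-- `0 ≤ Λ_e(R)` for `R ≥ 0`: it is the integral of a nonnegative function. [folklore] -/
theorem liaWindowCoeff_nonneg {e : ℝ} (he : 0 < e) {R : ℝ} (hR : 0 ≤ R) :
    0 ≤ (Real.arsinh (R / e) - R / Real.sqrt (R ^ 2 + e ^ 2)) := by
  rw [← integral_window_model he 0 hR]
  refine intervalIntegral.integral_nonneg (by linarith) fun σ _ => ?_
  exact mul_nonneg (kernel_pos e (σ - 0) he).le (by positivity)

/-! ## §2 Pointwise majorants for the self-strand integrand -/

variable {X : ℝ → EuclideanSpace ℝ (Fin 3)}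

/-- The self-strand integrand is continuous in `σ` (for a `C²` curve; `e > 0`). [folklore] -/
theorem continuous_selfIntegrand (hX : ContDiff ℝ 2 X) {e : ℝ} (he : 0 < e) (τ : ℝ) :
    Continuous fun σ : ℝ => (((‖X τ - X σ‖ ^ 2 + e ^ 2) ^ (3 / 2 : ℝ))⁻¹ • cross (deriv X σ) (X τ - X σ)) := by
  have hXc : Continuous X := hX.continuous
  have hdc : Continuous (deriv X) := hX.continuous_deriv (by norm_num)
  have hb : ∀ u : ℝ, 0 < ‖X τ - X u‖ ^ 2 + e ^ 2 := fun u => by positivity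
  have hsc : Continuous fun u : ℝ => ((‖X τ - X u‖ ^ 2 + e ^ 2) ^ (3 / 2 : ℝ))⁻¹ :=
    ((((continuous_const.sub hXc).norm.pow 2).add continuous_const).rpow_const
      fun u => Or.inr (by norm_num)).inv₀ fun u => (Real.rpow_pos_of_pos (hb u) _).ne'
  have hcr : Continuous fun u : ℝ => cross (deriv X u) (X τ - X u) :=
    (crossCLM.continuous.comp hdc).clm_apply (continuous_const.sub hXc)
  exact hsc.smul hcr

/-- `‖T × v‖ ≤ ‖v‖` for a unit vector `T`. [folklore] -/
theorem norm_cross_unit_le {T : EuclideanSpace ℝ (Fin 3)} (hT : ‖T‖ = 1) (v : EuclideanSpace ℝ (Fin 3)) : ‖cross T v‖ ≤ ‖v‖ := by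
  have h := norm_cross_le_norm_mul_norm T v
  rwa [hT, one_mul] at h

/-- **INNER pointwise majorant** (`|σ − τ| ≤ R`, the logarithmic window).  Unit-speed `C²` curve; on the segment `[[τ, σ]]`: curvature `≤ κ`,
`‖X″q − X″τ‖ ≤ H|q − τ|` (`H ≥ 0`), chord `‖X σ − X τ‖ ≥ (1−η)|σ−τ|` with `0 ≤ η ≤ 1/2`; `‖X″τ‖ ≤ Eτ`.  Then
`‖F σ − G σ‖ ≤ 8H + 8κ² + 16η·Eτ·(K_e(σ−τ)(σ−τ)²/2)`. [folklore] -/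
theorem norm_selfIntegrand_sub_windowModel_le (hX : ContDiff ℝ 2 X) (hunit : ∀ s, ‖deriv X s‖ = 1) {e : ℝ} (he : 0 < e)
    {τ σ κ H η Eτ : ℝ} (hκ : ∀ p ∈ uIcc τ σ, ‖deriv (deriv X) p‖ ≤ κ) (hH0 : 0 ≤ H)
    (hH : ∀ q ∈ uIcc τ σ, ‖deriv (deriv X) q - deriv (deriv X) τ‖ ≤ H * |q - τ|)
    (hη0 : 0 ≤ η) (hη1 : η ≤ 1 / 2) (hchord : (1 - η) * |σ - τ| ≤ ‖X σ - X τ‖) (hE : ‖deriv (deriv X) τ‖ ≤ Eτ) :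
    ‖(((‖X τ - X σ‖ ^ 2 + e ^ 2) ^ (3 / 2 : ℝ))⁻¹ • cross (deriv X σ) (X τ - X σ)) -
        (((((σ - τ) ^ 2 + e ^ 2) ^ (3 / 2 : ℝ))⁻¹ * ((σ - τ) ^ 2 / 2)) • cross (deriv X τ) (deriv (deriv X) τ))‖ ≤
      8 * H + 8 * κ ^ 2 + 16 * η * Eτ * ((((σ - τ) ^ 2 + e ^ 2) ^ (3 / 2 : ℝ))⁻¹ * ((σ - τ) ^ 2 / 2)) := by
  set s := σ - τ with hs
  set Kc : ℝ := ((‖X τ - X σ‖ ^ 2 + e ^ 2) ^ (3 / 2 : ℝ))⁻¹ with hKc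
  set Ks : ℝ := ((s ^ 2 + e ^ 2) ^ (3 / 2 : ℝ))⁻¹ with hKs
  set A : EuclideanSpace ℝ (Fin 3) := s • deriv X σ - (X σ - X τ) with hA
  set R₂ : EuclideanSpace ℝ (Fin 3) := cross (deriv X σ - deriv X τ) ((X σ - X τ) - s • deriv X τ) with hR₂
  have hKc0 : 0 ≤ Kc := (kernel_pos e _ he).le
  have hKs0 : 0 ≤ Ks := (kernel_pos e _ he).le
  have hEτ0 : 0 ≤ Eτ := le_trans (norm_nonneg _) hE
  -- the split
  have hsplit : cross (deriv X σ) (X τ - X σ) = cross (deriv X τ) A - R₂ := cross_chord_split _ _ _ _ s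
  have hdiff : (((‖X τ - X σ‖ ^ 2 + e ^ 2) ^ (3 / 2 : ℝ))⁻¹ • cross (deriv X σ) (X τ - X σ)) -
        (((((σ - τ) ^ 2 + e ^ 2) ^ (3 / 2 : ℝ))⁻¹ * ((σ - τ) ^ 2 / 2)) • cross (deriv X τ) (deriv (deriv X) τ)) =
      Kc • cross (deriv X τ) (A - (s ^ 2 / 2) • deriv (deriv X) τ) +
        ((Kc - Ks) * (s ^ 2 / 2)) • cross (deriv X τ) (deriv (deriv X) τ) - Kc • R₂ := by
    simp only [hsplit, ← hKc, ← hs, ← hKs]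
    rw [← crossCLM_apply (deriv X τ) (A - (s ^ 2 / 2) • deriv (deriv X) τ), map_sub, map_smul]
    simp only [crossCLM_apply, smul_sub, sub_smul, mul_smul]
    abel
  -- chord facts
  have hchord' : ‖X τ - X σ‖ = ‖X σ - X τ‖ := norm_sub_rev _ _
  have hKcKs : Kc ≤ ((1 - η) ^ 3)⁻¹ * Ks := by
    rw [hKc, hchord']
    exact kernel_chord_le he hη0 (by linarith) hchord
  have hKcsub : Kc - Ks ≤ 16 * η * Ks := by
    rw [hKc, hchord']
    exact kernel_chord_sub_le he hη0 hη1 hchord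
  -- Kc · |s|³ ≤ 8 (cube moment ≤ 1 at the chord, chord ≥ (1−η)|s| ≥ |s|/2)
  have hKcs3 : Kc * |s| ^ 3 ≤ 8 := by
    have h1 : ‖X σ - X τ‖ ^ 3 * Kc ≤ 1 := by
      rw [hKc, hchord']; exact cube_mul_kernel_le_one (norm_nonneg _) he
    have h2 : |s| / 2 ≤ ‖X σ - X τ‖ := by
      have : (1:ℝ) / 2 * |s| ≤ (1 - η) * |s| := mul_le_mul_of_nonneg_right (by linarith) (abs_nonneg _)
      linarith
    have h3 : (|s| / 2) ^ 3 ≤ ‖X σ - X τ‖ ^ 3 := pow_le_pow_left₀ (by positivity) h2 3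
    nlinarith [mul_le_mul_of_nonneg_right h3 hKc0]
  -- the three pieces
  have hT := hunit τ
  have p1 : ‖Kc • cross (deriv X τ) (A - (s ^ 2 / 2) • deriv (deriv X) τ)‖ ≤ 8 * H := by
    rw [norm_smul, Real.norm_eq_abs, abs_of_nonneg hKc0]
    have hA2 : ‖A - (s ^ 2 / 2) • deriv (deriv X) τ‖ ≤ H * |s| ^ 3 := norm_firstOrderTerm_sub_model_le hX hH0 hH
    calc Kc * ‖cross (deriv X τ) (A - (s ^ 2 / 2) • deriv (deriv X) τ)‖ ≤ Kc * (H * |s| ^ 3) :=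
          mul_le_mul_of_nonneg_left ((norm_cross_unit_le hT _).trans hA2) hKc0
      _ = H * (Kc * |s| ^ 3) := by ring
      _ ≤ H * 8 := mul_le_mul_of_nonneg_left hKcs3 hH0
      _ = 8 * H := by ring
  have p2 : ‖((Kc - Ks) * (s ^ 2 / 2)) • cross (deriv X τ) (deriv (deriv X) τ)‖ ≤ 16 * η * Eτ * (Ks * (s ^ 2 / 2)) := by
    rw [norm_smul, Real.norm_eq_abs]
    have hnn : 0 ≤ Kc - Ks := by
      rw [hKc, hKs, hchord', sub_nonneg]
      -- K is decreasing and the chord is at most the arclength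
      have hle : ‖X σ - X τ‖ ≤ |s| := by
        have hd : Differentiable ℝ X := hX.differentiable (by norm_num)
        have h := Convex.norm_image_sub_le_of_norm_deriv_le (f := X) (C := 1) (s := Set.univ) (fun x _ => hd x)
          (fun x _ => (hunit x).le) convex_univ (Set.mem_univ τ) (Set.mem_univ σ)
        rwa [one_mul, Real.norm_eq_abs] at h
      refine inv_anti₀ (Real.rpow_pos_of_pos (by positivity) _) (Real.rpow_le_rpow (by positivity) ?_ (by norm_num))
      nlinarith [sq_abs s, pow_le_pow_left₀ (norm_nonneg _) hle 2]
    rw [abs_of_nonneg (mul_nonneg hnn (by positivity))]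
    have hCE : ‖cross (deriv X τ) (deriv (deriv X) τ)‖ ≤ Eτ := (norm_cross_unit_le hT _).trans hE
    have h16 : 0 ≤ 16 * η * Ks * (s ^ 2 / 2) := mul_nonneg (mul_nonneg (by positivity) hKs0) (by positivity)
    calc (Kc - Ks) * (s ^ 2 / 2) * ‖cross (deriv X τ) (deriv (deriv X) τ)‖
        ≤ (16 * η * Ks) * (s ^ 2 / 2) * Eτ :=
          mul_le_mul (mul_le_mul_of_nonneg_right hKcsub (by positivity)) hCE (norm_nonneg _) h16
      _ = 16 * η * Eτ * (Ks * (s ^ 2 / 2)) := by ring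
  have p3 : ‖Kc • R₂‖ ≤ 8 * κ ^ 2 := by
    rw [norm_smul, Real.norm_eq_abs, abs_of_nonneg hKc0]
    have hR : ‖R₂‖ ≤ κ ^ 2 * |s| ^ 3 := norm_secondOrderTerm_le_of_curvature hX hκ
    calc Kc * ‖R₂‖ ≤ Kc * (κ ^ 2 * |s| ^ 3) := mul_le_mul_of_nonneg_left hR hKc0
      _ = κ ^ 2 * (Kc * |s| ^ 3) := by ring
      _ ≤ κ ^ 2 * 8 := mul_le_mul_of_nonneg_left hKcs3 (sq_nonneg κ)
      _ = 8 * κ ^ 2 := by ring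
  rw [hdiff]
  calc ‖Kc • cross (deriv X τ) (A - (s ^ 2 / 2) • deriv (deriv X) τ) +
        ((Kc - Ks) * (s ^ 2 / 2)) • cross (deriv X τ) (deriv (deriv X) τ) - Kc • R₂‖
      ≤ ‖Kc • cross (deriv X τ) (A - (s ^ 2 / 2) • deriv (deriv X) τ)‖ +
        ‖((Kc - Ks) * (s ^ 2 / 2)) • cross (deriv X τ) (deriv (deriv X) τ)‖ + ‖Kc • R₂‖ :=
          (norm_sub_le _ _).trans (by gcongr; exact norm_add_le _ _)
    _ ≤ 8 * H + 16 * η * Eτ * (Ks * (s ^ 2 / 2)) + 8 * κ ^ 2 := by linarith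
    _ = 8 * H + 8 * κ ^ 2 + 16 * η * Eτ * (Ks * (s ^ 2 / 2)) := by ring

/-- **OUTER pointwise majorant.**  Unit-speed `C²` curve, chord `‖X σ − X τ‖ ≥ c|σ − τ|` (`c > 0`, `σ ≠ τ`), and bounds `‖A‖ ≤ gA`,
`‖R₂‖ ≤ gR` on the first- and second-order terms of the split at `σ`.  Then `‖F σ‖ ≤ (gA + gR)/(c³|σ−τ|³)`. [folklore] -/
theorem norm_selfIntegrand_le_outer (e : ℝ) (he : 0 < e) (hunit : ∀ s, ‖deriv X s‖ = 1) {τ σ c gA gR : ℝ} (hc : 0 < c)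
    (hστ : σ ≠ τ) (hchord : c * |σ - τ| ≤ ‖X σ - X τ‖)
    (hgA : ‖(σ - τ) • deriv X σ - (X σ - X τ)‖ ≤ gA)
    (hgR : ‖cross (deriv X σ - deriv X τ) ((X σ - X τ) - (σ - τ) • deriv X τ)‖ ≤ gR) :
    ‖(((‖X τ - X σ‖ ^ 2 + e ^ 2) ^ (3 / 2 : ℝ))⁻¹ • cross (deriv X σ) (X τ - X σ))‖ ≤ (gA + gR) / (c ^ 3 * |σ - τ| ^ 3) := by
  have hs : 0 < |σ - τ| := abs_pos.2 (sub_ne_zero.2 hστ)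
  have hr : 0 < ‖X σ - X τ‖ := lt_of_lt_of_le (by positivity) hchord
  have hsplit : cross (deriv X σ) (X τ - X σ) =
      cross (deriv X τ) ((σ - τ) • deriv X σ - (X σ - X τ)) -
        cross (deriv X σ - deriv X τ) ((X σ - X τ) - (σ - τ) • deriv X τ) := cross_chord_split _ _ _ _ _
  rw [norm_smul, Real.norm_eq_abs, abs_of_nonneg (kernel_pos e _ he).le, norm_sub_rev (X τ), hsplit]
  have hK : ((‖X σ - X τ‖ ^ 2 + e ^ 2) ^ (3 / 2 : ℝ))⁻¹ ≤ (c ^ 3 * |σ - τ| ^ 3)⁻¹ := by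
    refine (kernel_le_inv_cube hr e).trans (inv_anti₀ (by positivity) ?_)
    rw [← mul_pow]; exact pow_le_pow_left₀ (by positivity) hchord 3
  have hv : ‖cross (deriv X τ) ((σ - τ) • deriv X σ - (X σ - X τ)) -
      cross (deriv X σ - deriv X τ) ((X σ - X τ) - (σ - τ) • deriv X τ)‖ ≤ gA + gR :=
    (norm_sub_le _ _).trans (add_le_add ((norm_cross_unit_le (hunit τ) _).trans hgA) hgR)
  rw [div_eq_mul_inv (gA + gR), mul_comm (gA + gR)]
  exact mul_le_mul hK hv (norm_nonneg _) (by positivity)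

/-! ## §3 The majorant frame -/

/-- **Self strand against the local-induction model, majorant form.**  Unit-speed `C²` curve, `e > 0`, `R ≥ 0`, and an integrable `m` with
`‖F σ − 𝟙_{[τ−R, τ+R]}(σ)·G σ‖ ≤ m σ` for all `σ`.  Then `F` is integrable and `‖∫ F dσ − Λ_e(R) • X′τ × X″τ‖ ≤ ∫ m`. [folklore] -/
theorem selfStrand_sub_lia_le_of_majorant (hX : ContDiff ℝ 2 X) {e : ℝ} (he : 0 < e) (τ : ℝ) {R : ℝ} (hR : 0 ≤ R)
    {m : ℝ → ℝ} (hm : Integrable m)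
    (hmaj : ∀ σ, ‖(((‖X τ - X σ‖ ^ 2 + e ^ 2) ^ (3 / 2 : ℝ))⁻¹ • cross (deriv X σ) (X τ - X σ)) -
        (Icc (τ - R) (τ + R)).indicator
          (fun σ => (((((σ - τ) ^ 2 + e ^ 2) ^ (3 / 2 : ℝ))⁻¹ * ((σ - τ) ^ 2 / 2)) • cross (deriv X τ) (deriv (deriv X) τ))) σ‖ ≤ m σ) :
    Integrable (fun σ : ℝ => (((‖X τ - X σ‖ ^ 2 + e ^ 2) ^ (3 / 2 : ℝ))⁻¹ • cross (deriv X σ) (X τ - X σ))) ∧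
      ‖(∫ σ, (((‖X τ - X σ‖ ^ 2 + e ^ 2) ^ (3 / 2 : ℝ))⁻¹ • cross (deriv X σ) (X τ - X σ))) -
          (Real.arsinh (R / e) - R / Real.sqrt (R ^ 2 + e ^ 2)) • cross (deriv X τ) (deriv (deriv X) τ)‖ ≤ ∫ σ, m σ := by
  set F : ℝ → EuclideanSpace ℝ (Fin 3) := fun σ => (((‖X τ - X σ‖ ^ 2 + e ^ 2) ^ (3 / 2 : ℝ))⁻¹ • cross (deriv X σ) (X τ - X σ)) with hF
  set G : ℝ → EuclideanSpace ℝ (Fin 3) := (Icc (τ - R) (τ + R)).indicator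
    (fun σ => (((((σ - τ) ^ 2 + e ^ 2) ^ (3 / 2 : ℝ))⁻¹ * ((σ - τ) ^ 2 / 2)) • cross (deriv X τ) (deriv (deriv X) τ))) with hG
  -- the model is integrable and integrates to Λ • (X′τ × X″τ)
  have hgc : Continuous fun σ : ℝ => (((σ - τ) ^ 2 + e ^ 2) ^ (3 / 2 : ℝ))⁻¹ * ((σ - τ) ^ 2 / 2) := by
    refine Continuous.mul ?_ (((continuous_id.sub continuous_const).pow 2).div_const 2)
    exact ((((continuous_id.sub continuous_const).pow 2).add continuous_const).rpow_const
      fun _ => Or.inr (by norm_num)).inv₀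
      fun σ => (Real.rpow_pos_of_pos (by positivity : (0:ℝ) < (σ - τ) ^ 2 + e ^ 2) _).ne'
  have hWc : Continuous fun σ : ℝ => (((((σ - τ) ^ 2 + e ^ 2) ^ (3 / 2 : ℝ))⁻¹ * ((σ - τ) ^ 2 / 2)) • cross (deriv X τ) (deriv (deriv X) τ)) :=
    hgc.smul continuous_const
  have hGint : Integrable G := (hWc.integrableOn_Icc (a := τ - R) (b := τ + R)).integrable_indicator measurableSet_Icc
  have hGval : ∫ σ, G σ = (Real.arsinh (R / e) - R / Real.sqrt (R ^ 2 + e ^ 2)) • cross (deriv X τ) (deriv (deriv X) τ) := by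
    rw [hG, MeasureTheory.integral_indicator measurableSet_Icc, integral_Icc_eq_integral_Ioc,
      ← intervalIntegral.integral_of_le (by linarith : τ - R ≤ τ + R),
      intervalIntegral.integral_smul_const, integral_window_model he τ hR]
  -- F = (F − G) + G is integrable
  have hFc : Continuous F := continuous_selfIntegrand hX he τ
  have hdiff_int : Integrable (fun σ => F σ - G σ) :=
    Integrable.mono' hm (hFc.aestronglyMeasurable.sub hGint.aestronglyMeasurable) (Eventually.of_forall hmaj)
  have hFint : Integrable F := by
    have h := hdiff_int.add hGint
    have heq : ((fun σ => F σ - G σ) + G) = F := by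
      funext σ; simp only [Pi.add_apply, sub_add_cancel]
    rwa [heq] at h
  refine ⟨hFint, ?_⟩
  rw [← hGval, ← integral_sub hFint hGint]
  exact norm_integral_le_of_norm_le hm (Eventually.of_forall hmaj)

end Summit.NavierStokesRegularity.NavierStokesRegularity.Theorems.SkeletonJ1RLiaSelf

end
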